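import Mathlib
import Summits.Ventures.PercRepro2.Defs
import Summits.Ventures.PercRepro2.Graph
import Summits.Ventures.PercRepro2.OneColourSwitch
import Summits.Ventures.PercRepro2.RegionHubSign
import Summits.Ventures.PercRepro2.SideSwitch
import Summits.Ventures.PercRepro2.M9NoPocketDefs
import Summits.Ventures.PercRepro2.M9PocketRSEdgeTransfer
import Summits.Ventures.PercRepro2.M9PocketRootOnlyTransfer
import Summits.Ventures.PercRepro2.M9PocketRootOnlyPTransfer
import Summits.Ventures.PercRepro2.M9PocketRootOnlyPWorlds

/-!
# A cluster hanging from `{r, s, p}` — the single-`d` data transfer (blind cell PercRepro2,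
p3 g41, 2026-08-29; `proofs/P3-POCKETRK.md` §10⁵ (j))

With `F` = the edges inside `L ∪ {r, s, p}` and the ADMISSIBILITY of a colouring of `F`
«`p` is `F`-joined to neither `r` nor `s` in either colour»: `Sep` transfers to the restriction
(`sep2_restrict_iff_p`), `DOne` splits into `DOne` of the restriction and «no vertex of `L`
other than `d` in both worlds of the `F`-graph» (`DOne_restrict_iff_p`, under `Sep`), `σ_pq` is
unchanged (`sigma_pq_restrict_eq_p`), and `r ~_Y s` is the disjunction of the two links
(`conn_rs_restrict_iff_p`); then the glue lemmas for the decomposition of a colouring of `G` into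
a colouring of the edges off `F` and one of `F` (`Equiv.piEquivPiSubtypeProd`).  Own work;
std axioms.
-/

namespace Summit.Ventures.PercRepro2

namespace NoPocket

open Finset Classical OneColourSwitch SideSwitch

variable {V : Type*} {E : Type*} {ends : E → Sym2 V} {p q r s d : V} {ω : Config E} {L : Set V}

section TransferP

/-- **`Sep` transfers** under the admissibility of the `F`-colouring. -/
lemma sep2_restrict_iff_p
    (hL : ∀ e x y, ends e = s(x, y) → x ∈ L → y ∈ L ∨ y = r ∨ y = s ∨ y = p)
    (hp : p ∉ L) (hq : q ∉ L)
    (h3 : ¬ Conn (fun e : {e // ¬ (e ∉ within ends (L ∪ {r, s, p} : Set V))} => ends e.1)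
      (fun e => ω e.1) p r)
    (h4 : ¬ Conn (fun e : {e // ¬ (e ∉ within ends (L ∪ {r, s, p} : Set V))} => ends e.1)
      (fun e => ω e.1) p s)
    (h3' : ¬ Conn (fun e : {e // ¬ (e ∉ within ends (L ∪ {r, s, p} : Set V))} => ends e.1)
      (fun e => OneColourSwitch.compl ω e.1) p r)
    (h4' : ¬ Conn (fun e : {e // ¬ (e ∉ within ends (L ∪ {r, s, p} : Set V))} => ends e.1)
      (fun e => OneColourSwitch.compl ω e.1) p s) :
    sep2 ends p q r s ω ↔
      sep2 (fun e : {e // e ∉ within ends (L ∪ {r, s, p} : Set V)} => ends e.1) p q r s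
        (fun e => ω e.1) := by
  constructor
  · rintro ⟨⟨h1, h2, h5, h6⟩, ⟨h7, h8, h9, h10⟩⟩
    exact ⟨⟨fun h => h1 (conn_of_conn_restrict h), fun h => h2 (conn_of_conn_restrict h),
      fun h => h5 (conn_of_conn_restrict h), fun h => h6 (conn_of_conn_restrict h)⟩,
      ⟨fun h => h7 (conn_of_conn_restrict (ω := OneColourSwitch.compl ω) h),
      fun h => h8 (conn_of_conn_restrict (ω := OneColourSwitch.compl ω) h),
      fun h => h9 (conn_of_conn_restrict (ω := OneColourSwitch.compl ω) h),
      fun h => h10 (conn_of_conn_restrict (ω := OneColourSwitch.compl ω) h)⟩⟩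
  · rintro ⟨⟨h1, h2, h5, h6⟩, ⟨h7, h8, h9, h10⟩⟩
    exact ⟨⟨not_conn_p_mark_of_restrict hL hp (Or.inl rfl) h1 h2 h3 h4,
      not_conn_p_mark_of_restrict hL hp (Or.inr rfl) h1 h2 h3 h4,
      not_conn_q_mark_of_restrict hL hq (Or.inl rfl) h5 h6 h3 h4,
      not_conn_q_mark_of_restrict hL hq (Or.inr rfl) h5 h6 h3 h4⟩,
      ⟨not_conn_p_mark_of_restrict (ω := OneColourSwitch.compl ω) hL hp (Or.inl rfl) h7 h8 h3' h4',
      not_conn_p_mark_of_restrict (ω := OneColourSwitch.compl ω) hL hp (Or.inr rfl) h7 h8 h3' h4',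
      not_conn_q_mark_of_restrict (ω := OneColourSwitch.compl ω) hL hq (Or.inl rfl) h9 h10 h3' h4',
      not_conn_q_mark_of_restrict (ω := OneColourSwitch.compl ω) hL hq (Or.inr rfl) h9 h10
        h3' h4'⟩⟩

/-- **`DOne` splits** at a `Sep` point with admissible `F`-colouring. -/
lemma DOne_restrict_iff_p
    (hL : ∀ e x y, ends e = s(x, y) → x ∈ L → y ∈ L ∨ y = r ∨ y = s ∨ y = p)
    (hr : r ∉ L) (hs : s ∉ L) (hsep : sep2 ends p q r s ω)
    (h3 : ¬ Conn (fun e : {e // ¬ (e ∉ within ends (L ∪ {r, s, p} : Set V))} => ends e.1)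
      (fun e => ω e.1) p r)
    (h4 : ¬ Conn (fun e : {e // ¬ (e ∉ within ends (L ∪ {r, s, p} : Set V))} => ends e.1)
      (fun e => ω e.1) p s)
    (h3' : ¬ Conn (fun e : {e // ¬ (e ∉ within ends (L ∪ {r, s, p} : Set V))} => ends e.1)
      (fun e => OneColourSwitch.compl ω e.1) p r)
    (h4' : ¬ Conn (fun e : {e // ¬ (e ∉ within ends (L ∪ {r, s, p} : Set V))} => ends e.1)
      (fun e => OneColourSwitch.compl ω e.1) p s) :
    DOne ends r s d ω ↔
      DOne (fun e : {e // e ∉ within ends (L ∪ {r, s, p} : Set V)} => ends e.1) r s d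
        (fun e => ω e.1) ∧
      ∀ x ∈ L, x ≠ d →
        x ∈ K2 (fun e : {e // ¬ (e ∉ within ends (L ∪ {r, s, p} : Set V))} => ends e.1) r s
          (fun e => ω e.1) →
        x ∉ M2 (fun e : {e // ¬ (e ∉ within ends (L ∪ {r, s, p} : Set V))} => ends e.1) r s
          (fun e => ω e.1) := by
  obtain ⟨⟨hpr, hps, _, _⟩, ⟨hpr', hps', _, _⟩⟩ := hsep
  -- the conditions of the world lemmas, for `ω` and for its flip
  have e1 : ¬ Conn (fun e : {e // e ∉ within ends (L ∪ {r, s, p} : Set V)} => ends e.1)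
      (fun e => ω e.1) r p := fun h => hpr (conn_symm (conn_of_conn_restrict h))
  have e2 : ¬ Conn (fun e : {e // e ∉ within ends (L ∪ {r, s, p} : Set V)} => ends e.1)
      (fun e => ω e.1) s p := fun h => hps (conn_symm (conn_of_conn_restrict h))
  have e3 : ¬ Conn (fun e : {e // ¬ (e ∉ within ends (L ∪ {r, s, p} : Set V))} => ends e.1)
      (fun e => ω e.1) r p := fun h => h3 (conn_symm h)
  have e4 : ¬ Conn (fun e : {e // ¬ (e ∉ within ends (L ∪ {r, s, p} : Set V))} => ends e.1)
      (fun e => ω e.1) s p := fun h => h4 (conn_symm h)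
  have e1' : ¬ Conn (fun e : {e // e ∉ within ends (L ∪ {r, s, p} : Set V)} => ends e.1)
      (fun e => OneColourSwitch.compl ω e.1) r p :=
    fun h => hpr' (conn_symm (conn_of_conn_restrict h))
  have e2' : ¬ Conn (fun e : {e // e ∉ within ends (L ∪ {r, s, p} : Set V)} => ends e.1)
      (fun e => OneColourSwitch.compl ω e.1) s p :=
    fun h => hps' (conn_symm (conn_of_conn_restrict h))
  have e3' : ¬ Conn (fun e : {e // ¬ (e ∉ within ends (L ∪ {r, s, p} : Set V))} => ends e.1)
      (fun e => OneColourSwitch.compl ω e.1) r p := fun h => h3' (conn_symm h)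
  have e4' : ¬ Conn (fun e : {e // ¬ (e ∉ within ends (L ∪ {r, s, p} : Set V))} => ends e.1)
      (fun e => OneColourSwitch.compl ω e.1) s p := fun h => h4' (conn_symm h)
  have hGr : ¬ Conn ends ω r p := fun h => hpr (conn_symm h)
  have hGs : ¬ Conn ends ω s p := fun h => hps (conn_symm h)
  have hGr' : ¬ Conn ends (OneColourSwitch.compl ω) r p := fun h => hpr' (conn_symm h)
  have hGs' : ¬ Conn ends (OneColourSwitch.compl ω) s p := fun h => hps' (conn_symm h)
  -- the `W`-world statements are the `Y`-world statements for the flipped colouring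
  have hK : ∀ {x : V}, x ∉ L → (x ∈ K2 ends r s ω ↔
      x ∈ K2 (fun e : {e // e ∉ within ends (L ∪ {r, s, p} : Set V)} => ends e.1) r s
        (fun e => ω e.1)) :=
    fun hx => mem_K2_restrict_iff_of_notMem_p hL hr hs e1 e2 e3 e4 hx
  have hM : ∀ {x : V}, x ∉ L → (x ∈ M2 ends r s ω ↔
      x ∈ M2 (fun e : {e // e ∉ within ends (L ∪ {r, s, p} : Set V)} => ends e.1) r s
        (fun e => ω e.1)) :=
    fun hx => mem_K2_restrict_iff_of_notMem_p (ω := OneColourSwitch.compl ω) hL hr hs e1' e2'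
      e3' e4' hx
  have hKF : ∀ {x : V}, x ∈ L → (x ∈ K2 ends r s ω ↔
      x ∈ K2 (fun e : {e // ¬ (e ∉ within ends (L ∪ {r, s, p} : Set V))} => ends e.1) r s
        (fun e => ω e.1)) :=
    fun hx => mem_K2_F_iff_of_mem_p hL hr hs hGr hGs hx
  have hMF : ∀ {x : V}, x ∈ L → (x ∈ M2 ends r s ω ↔
      x ∈ M2 (fun e : {e // ¬ (e ∉ within ends (L ∪ {r, s, p} : Set V))} => ends e.1) r s
        (fun e => ω e.1)) :=
    fun hx => mem_K2_F_iff_of_mem_p (ω := OneColourSwitch.compl ω) hL hr hs hGr' hGs' hx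
  constructor
  · intro h
    refine ⟨?_, ?_⟩
    · intro x hxr hxs hxd hK' hM'
      by_cases hxL : x ∈ L
      · rcases mem_K2_iff.1 hK' with h' | h'
        · exact notMem_L_of_conn_restrict_p hL hr h' hxL
        · exact notMem_L_of_conn_restrict_p hL hs h' hxL
      · exact h x hxr hxs hxd ((hK hxL).2 hK') ((hM hxL).2 hM')
    · intro x hxL hxd hK' hM'
      have hxr : x ≠ r := fun h' => hr (h' ▸ hxL)
      have hxs : x ≠ s := fun h' => hs (h' ▸ hxL)
      exact h x hxr hxs hxd ((hKF hxL).2 hK') ((hMF hxL).2 hM')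
  · rintro ⟨h1, h2⟩ x hxr hxs hxd hK' hM'
    by_cases hxL : x ∈ L
    · exact h2 x hxL hxd ((hKF hxL).1 hK') ((hMF hxL).1 hM')
    · exact h1 x hxr hxs hxd ((hK hxL).1 hK') ((hM hxL).1 hM')

/-- **`σ_pq` is unchanged** at a `Sep` point with admissible `F`-colouring. -/
lemma sigma_pq_restrict_eq_p
    (hL : ∀ e x y, ends e = s(x, y) → x ∈ L → y ∈ L ∨ y = r ∨ y = s ∨ y = p)
    (hp : p ∉ L) (hq : q ∉ L) (hsep : sep2 ends p q r s ω)
    (h3 : ¬ Conn (fun e : {e // ¬ (e ∉ within ends (L ∪ {r, s, p} : Set V))} => ends e.1)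
      (fun e => ω e.1) p r)
    (h4 : ¬ Conn (fun e : {e // ¬ (e ∉ within ends (L ∪ {r, s, p} : Set V))} => ends e.1)
      (fun e => ω e.1) p s)
    (h3' : ¬ Conn (fun e : {e // ¬ (e ∉ within ends (L ∪ {r, s, p} : Set V))} => ends e.1)
      (fun e => OneColourSwitch.compl ω e.1) p r)
    (h4' : ¬ Conn (fun e : {e // ¬ (e ∉ within ends (L ∪ {r, s, p} : Set V))} => ends e.1)
      (fun e => OneColourSwitch.compl ω e.1) p s) :
    sigma ends ω p q =
      sigma (fun e : {e // e ∉ within ends (L ∪ {r, s, p} : Set V)} => ends e.1) (fun e => ω e.1)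
        p q := by
  obtain ⟨⟨hpr, hps, _, _⟩, ⟨hpr', hps', _, _⟩⟩ := hsep
  have hY := conn_pq_restrict_iff_of_sep hL hp hq (fun h => hpr (conn_of_conn_restrict h))
    (fun h => hps (conn_of_conn_restrict h)) h3 h4
  have hW := conn_pq_restrict_iff_of_sep (ω := OneColourSwitch.compl ω) hL hp hq
    (fun h => hpr' (conn_of_conn_restrict h)) (fun h => hps' (conn_of_conn_restrict h)) h3' h4'
  unfold sigma
  rw [if_congr hY rfl rfl, if_congr hW rfl rfl]
  rfl

/-- **`r ~_Y s` iff it holds in the restriction or in the `F`-graph.** -/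
lemma conn_rs_restrict_iff_p
    (hL : ∀ e x y, ends e = s(x, y) → x ∈ L → y ∈ L ∨ y = r ∨ y = s ∨ y = p)
    (hr : r ∉ L) (hs : s ∉ L)
    (h1 : ¬ Conn (fun e : {e // e ∉ within ends (L ∪ {r, s, p} : Set V)} => ends e.1)
      (fun e => ω e.1) r p)
    (h2 : ¬ Conn (fun e : {e // e ∉ within ends (L ∪ {r, s, p} : Set V)} => ends e.1)
      (fun e => ω e.1) s p)
    (h3 : ¬ Conn (fun e : {e // ¬ (e ∉ within ends (L ∪ {r, s, p} : Set V))} => ends e.1)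
      (fun e => ω e.1) r p)
    (h4 : ¬ Conn (fun e : {e // ¬ (e ∉ within ends (L ∪ {r, s, p} : Set V))} => ends e.1)
      (fun e => ω e.1) s p) :
    Conn ends ω r s ↔
      Conn (fun e : {e // e ∉ within ends (L ∪ {r, s, p} : Set V)} => ends e.1) (fun e => ω e.1)
        r s ∨
      Conn (fun e : {e // ¬ (e ∉ within ends (L ∪ {r, s, p} : Set V))} => ends e.1)
        (fun e => ω e.1) r s := by
  constructor
  · intro h
    rcases reach_of_conn_r hL hr hs h1 h2 h3 h4 h with h' | h' | ⟨h', _⟩ | ⟨h', _⟩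
    · exact Or.inl h'
    · exact Or.inr h'
    · exact Or.inr h'
    · exact Or.inl h'
  · rintro (h | h)
    · exact conn_of_conn_restrict h
    · exact conn_of_conn_restrict h

end TransferP

section GlueP

/-- The restriction of the glued colouring to the edges off `F` is its first component. -/
lemma restrict_glue_p (ω' : {e // e ∉ within ends (L ∪ {r, s, p} : Set V)} → Bool)
    (τ : {e // ¬ (e ∉ within ends (L ∪ {r, s, p} : Set V))} → Bool) :
    (fun e : {e // e ∉ within ends (L ∪ {r, s, p} : Set V)} =>
      (Equiv.piEquivPiSubtypeProd (fun e => e ∉ within ends (L ∪ {r, s, p} : Set V))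
        (fun _ => Bool)).symm (ω', τ) e.1) = ω' := by
  funext e
  rw [Equiv.piEquivPiSubtypeProd_symm_apply]
  exact dif_pos e.2

/-- The restriction of the glued colouring to `F` is its second component. -/
lemma restrictF_glue_p (ω' : {e // e ∉ within ends (L ∪ {r, s, p} : Set V)} → Bool)
    (τ : {e // ¬ (e ∉ within ends (L ∪ {r, s, p} : Set V))} → Bool) :
    (fun e : {e // ¬ (e ∉ within ends (L ∪ {r, s, p} : Set V))} =>
      (Equiv.piEquivPiSubtypeProd (fun e => e ∉ within ends (L ∪ {r, s, p} : Set V))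
        (fun _ => Bool)).symm (ω', τ) e.1) = τ := by
  funext e
  rw [Equiv.piEquivPiSubtypeProd_symm_apply]
  exact dif_neg e.2

/-- The colour flip commutes with the glue. -/
lemma compl_glue_p (ω' : {e // e ∉ within ends (L ∪ {r, s, p} : Set V)} → Bool)
    (τ : {e // ¬ (e ∉ within ends (L ∪ {r, s, p} : Set V))} → Bool) :
    OneColourSwitch.compl ((Equiv.piEquivPiSubtypeProd
        (fun e => e ∉ within ends (L ∪ {r, s, p} : Set V)) (fun _ => Bool)).symm (ω', τ)) =
      (Equiv.piEquivPiSubtypeProd (fun e => e ∉ within ends (L ∪ {r, s, p} : Set V))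
        (fun _ => Bool)).symm (OneColourSwitch.compl ω', OneColourSwitch.compl τ) := by
  funext e
  simp only [OneColourSwitch.compl, Equiv.piEquivPiSubtypeProd_symm_apply]
  split_ifs <;> rfl

/-- The `F`-restriction of the flipped glued colouring is the flip of `τ`. -/
lemma restrictF_compl_glue_p (ω' : {e // e ∉ within ends (L ∪ {r, s, p} : Set V)} → Bool)
    (τ : {e // ¬ (e ∉ within ends (L ∪ {r, s, p} : Set V))} → Bool) :
    (fun e : {e // ¬ (e ∉ within ends (L ∪ {r, s, p} : Set V))} =>
      OneColourSwitch.compl ((Equiv.piEquivPiSubtypeProd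
        (fun e => e ∉ within ends (L ∪ {r, s, p} : Set V)) (fun _ => Bool)).symm (ω', τ)) e.1) =
      OneColourSwitch.compl τ := by
  rw [compl_glue_p, restrictF_glue_p]

end GlueP

end NoPocket

end Summit.Ventures.PercRepro2
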